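import Mathlib.NumberTheory.ModularForms.EisensteinSeries.E2.Summable
import Mathlib.NumberTheory.ModularForms.EisensteinSeries.E2.Transform
import Mathlib.NumberTheory.ModularForms.EisensteinSeries.E2.MDifferentiable
import Literature.NumberTheory.EllipticCurves.EisensteinSeriesNebentypusCusps
import Literature.NumberTheory.EllipticCurves.NewformsMainLemma
import Literature.NumberTheory.EllipticCurves.ModularFormsRamanujan
import Literature.FieldTheory.AlgClosed.PadicAlgClEquivComplex
import HarnessLib

/-!
# The weight-2 Eisenstein series `E₂(z) - M E₂(Mz)` on `Γ₀(M)` (Mazur's Eisenstein series)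

Topic `Literature/NumberTheory/EllipticCurves`; namespace
`Literature.NumberTheory.EllipticCurves.ModularForms`.

From Mathlib's quasimodular `E₂` (`EisensteinSeries.E2`, with `E2_slash_action`:
`E₂ ∣₂ γ = E₂ - (1/2ζ(2)) D₂(γ)`, `D₂(γ)(z) = 2πi c/(cz+d)`) we build the holomorphic modular
form of weight `2`

  `E₂^{(M)}(z) = E₂(z) - M E₂(Mz) = E₂ - E₂ ∣₂ diag(M,1)`,  `q`-expansion
  `(1 - M) - 24 ∑_{n ≥ 1} (σ₁(n) - M [M ∣ n] σ₁(n/M)) qⁿ`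

on `Γ₀(M)` (`mazurEisensteinMF M`, a `ModularForm (Gamma1 M) 2` invariant under `Γ₀(M)`, for
`M` prime): the unique Eisenstein series of weight `2` and prime level `M`, `-24 ×` Mazur's
`E = (M-1)/24 · (1 - 24/(M-1) ∑ σ'(n) qⁿ)` — the Eisenstein series of Billerey–Menares, Thm. 1 /
§3.2 in the excluded case `(N, k) = (1, 2)` ("théorème de Mazur").  We prove: the function and
`Γ₀(M)`-invariance (`mazurE2_slash_of_mem_gamma0`, from `diag(M,1) γ = γ' diag(M,1)` and
`D₂(γ') ∣₂ diag(M,1) = D₂(γ)`), holomorphy, `D₂(γ) → 0` at `i∞` (`tendsto_D2_atImInfty`; the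
value `1` of `E₂` at `i∞` is the tree's `tendsto_E2_atImInfty`, `ModularFormsRamanujan`), the
constant terms of
`E₂^{(M)} ∣₂ γ` at ALL cusps — `1 - M` if `M ∣ c`, `1 - 1/M` if `gcd(c, M) = 1`
(`tendsto_mazurE2_slash_atImInfty_of_dvd/_of_isCoprime`) — the `q`-expansion
(`qExpansion_coeff_mazurEisensteinMF`), its `p`-integrality, and the vanishing modulo `p` of all
constant terms when `p ∣ M - 1` (`exists_tendsto_mazurEisensteinMF_slash_valuation_lt_one`) —
the hypothesis "`l ∣ M - 1`" of Mazur's theorem / "`M^{k} η(M) = 1`, `(N,k) = (1,2)`" of B–M.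

## References

* N. Billerey, R. Menares, *Strong modularity of reducible Galois representations*, Trans. AMS
  370 (2018), Thm. 1 and §3.2. [BillereyMenares2018]
* B. Mazur, *Modular curves and the Eisenstein ideal*, Publ. Math. IHÉS 47 (1977), II.5
  (the Eisenstein series `E` of weight `2` on `Γ₀(N)`). [Mazur1977]
* F. Diamond, J. Shurman, *A First Course in Modular Forms*, GTM 228 (2005), §1.2
  (`E₂(τ) - N E₂(Nτ) ∈ M₂(Γ₀(N))`), §5.7. [DiamondShurman2005]
-/

noncomputable section

open Complex UpperHalfPlane Filter Finset ModularForm CongruenceSubgroup Matrix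
  Matrix.SpecialLinearGroup EisensteinSeries Function
open scoped Real NNReal MatrixGroups Topology ArithmeticFunction.sigma

namespace Literature.NumberTheory.EllipticCurves.ModularForms

/-! ### `E₂` at `i∞`: `q`-expansion coefficients and `D₂(γ) → 0` -/

section E2Limits

/-- The `q`-expansion of `E₂` in Mathlib's `𝕢 1 τ` form. [folklore] -/
theorem hasSum_qExpansion_E2' (τ : ℍ) :
    HasSum (fun m : ℕ ↦ (if m = 0 then 1 else -24 * (σ 1 m : ℂ)) • Periodic.qParam 1 τ ^ m)
      (E2 τ) := by
  simpa only [Periodic.qParam, ofReal_one, div_one] using hasSum_qExpansion_E2 (z := τ)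

/-- The cusp function of `E₂` is analytic at `q = 0`. [folklore] -/
theorem analyticAt_cuspFunction_E2 : AnalyticAt ℂ (cuspFunction 1 E2) 0 :=
  analyticAt_cuspFunction_zero one_pos periodic_E2_comp_ofComplex E2_mdifferentiable
    isBoundedAtImInfty_E2

/-- **The `q`-expansion coefficients of `E₂`**: `a_0 = 1`, `a_n = -24 σ₁(n)` (uniqueness of
`q`-expansions, applied to `E₂` viewed as a continuous map so that Mathlib's `FunLike`-phrased
`qExpansion_coeff_unique` applies). [folklore] -/
theorem qExpansion_coeff_E2 (n : ℕ) :
    (qExpansion 1 E2).coeff n = if n = 0 then 1 else -24 * (σ 1 n : ℂ) := by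
  let E : C(ℍ, ℂ) := ⟨E2, E2_mdifferentiable.continuous⟩
  have hE : (⇑E : ℍ → ℂ) = E2 := rfl
  have h := UpperHalfPlane.qExpansion_coeff_unique (f := E)
    (c := fun m ↦ if m = 0 then (1 : ℂ) else -24 * (σ 1 m : ℂ)) one_pos
    (by rw [hE]; exact analyticAt_cuspFunction_E2) (fun τ ↦ by rw [hE]; exact hasSum_qExpansion_E2' τ) n
  rw [hE] at h
  exact h.symm

/-- **`D₂(γ)(τ) = 2πi c/(cτ + d) → 0` as `Im τ → ∞`.** [folklore] -/
theorem tendsto_D2_atImInfty (γ : SL(2, ℤ)) : Tendsto (D2 γ) atImInfty (𝓝 0) := by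
  by_cases hc : (γ 1 0 : ℤ) = 0
  · have : D2 γ = 0 := by
      funext z
      simp [D2, hc]
    rw [this]
    exact tendsto_const_nhds
  · rw [tendsto_zero_iff_norm_tendsto_zero]
    have hc' : (0 : ℝ) < |((γ 1 0 : ℤ) : ℝ)| := abs_pos.mpr (by exact_mod_cast hc)
    -- `‖D₂ γ z‖ ≤ 2π / Im z`
    have hbound : ∀ z : ℍ, ‖D2 γ z‖ ≤ 2 * π / z.im := by
      intro z
      have hden : |((γ 1 0 : ℤ) : ℝ)| * z.im ≤ ‖denom γ z‖ := by
        have h1 : (denom γ z).im = ((γ 1 0 : ℤ) : ℝ) * z.im := by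
          simp [denom]
        calc |((γ 1 0 : ℤ) : ℝ)| * z.im = |(denom γ z).im| := by
              rw [h1, abs_mul, abs_of_pos z.im_pos]
          _ ≤ ‖denom γ z‖ := Complex.abs_im_le_norm _
      have hdpos : 0 < |((γ 1 0 : ℤ) : ℝ)| * z.im := mul_pos hc' z.im_pos
      rw [D2, norm_div]
      have hnum : ‖2 * (π : ℂ) * Complex.I * ((γ 1 0 : ℤ) : ℂ)‖ = 2 * π * |((γ 1 0 : ℤ) : ℝ)| := by
        rw [norm_mul, norm_mul, norm_mul, Complex.norm_I, mul_one, Complex.norm_real,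
          Real.norm_of_nonneg Real.pi_pos.le, Complex.norm_two, Complex.norm_intCast]
      rw [hnum]
      calc 2 * π * |((γ 1 0 : ℤ) : ℝ)| / ‖denom (γ : GL (Fin 2) ℝ) z‖
          ≤ 2 * π * |((γ 1 0 : ℤ) : ℝ)| / (|((γ 1 0 : ℤ) : ℝ)| * z.im) := by
            apply div_le_div_of_nonneg_left (by positivity) hdpos
            simpa using hden
        _ = 2 * π / z.im := by
            field_simp
    refine squeeze_zero (fun z ↦ norm_nonneg _) hbound ?_
    have h := tendsto_im_atImInfty
    simpa using (tendsto_const_nhds (x := 2 * π)).div_atTop h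

/-- **`E₂ ∣₂ γ → 1` at `i∞` for every `γ ∈ SL₂(ℤ)`.** [folklore] -/
theorem tendsto_E2_slash_atImInfty (γ : SL(2, ℤ)) : Tendsto (E2 ∣[(2 : ℤ)] γ) atImInfty (𝓝 1) := by
  rw [E2_slash_action γ]
  have h := tendsto_E2_atImInfty.sub ((tendsto_D2_atImInfty γ).const_smul (1 / (2 * riemannZeta 2)))
  rw [smul_zero, sub_zero] at h
  exact h

end E2Limits

/-! ### `E₂^{(M)} = E₂ - E₂ ∣₂ diag(M,1)` -/

section Mazur

variable (M : ℕ) [NeZero M]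

/-- **Mazur's weight-2 Eisenstein function `E₂^{(M)}(z) = E₂(z) - M E₂(Mz) = E₂ - E₂ ∣₂ diag(M,1)`.**
[cite: DiamondShurman2005, §1.2; Mazur1977, II.5] -/
def mazurE2 : ℍ → ℂ :=
  E2 - E2 ∣[(2 : ℤ)] (glCast ((diagGL (M : ℚ) 1 (Nat.cast_pos.mpr (NeZero.pos M)) one_pos :
    GL(2, ℚ)⁺) : GL (Fin 2) ℚ))

/-- `(f ∣₂ diag(M,1))(τ) = M f(Mτ)`. [folklore] -/
theorem slash_two_diagGL_apply (f : ℍ → ℂ) (τ : ℍ) :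
    (f ∣[(2 : ℤ)] (glCast ((diagGL (M : ℚ) 1 (Nat.cast_pos.mpr (NeZero.pos M)) one_pos :
      GL(2, ℚ)⁺) : GL (Fin 2) ℚ))) τ =
      (M : ℂ) * f ((⟨(M : ℝ), Nat.cast_pos.mpr (NeZero.pos M)⟩ : {x : ℝ // 0 < x}) • τ) := by
  have h := smul_slash_diagGL_apply (2 : ℤ) M (NeZero.pos M) f τ
  rw [Pi.smul_apply, smul_eq_mul] at h
  have hM0 : (M : ℂ) ≠ 0 := by exact_mod_cast NeZero.ne M
  have hM1 : (M : ℂ) ^ (1 - 2 : ℤ) = (M : ℂ)⁻¹ := by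
    rw [show (1 - 2 : ℤ) = -1 by norm_num, _root_.zpow_neg_one]
  rw [hM1] at h
  rw [← h, ← mul_assoc, mul_inv_cancel₀ hM0, one_mul]

/-- **`E₂^{(M)}(τ) = E₂(τ) - M E₂(Mτ)`.** [cite: DiamondShurman2005, §1.2] -/
theorem mazurE2_apply (τ : ℍ) :
    mazurE2 M τ = E2 τ - (M : ℂ) *
      E2 ((⟨(M : ℝ), Nat.cast_pos.mpr (NeZero.pos M)⟩ : {x : ℝ // 0 < x}) • τ) := by
  rw [mazurE2, Pi.sub_apply, slash_two_diagGL_apply]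

/-- **`D₂(γ') ∣₂ diag(M,1) = D₂(γ)`** for `γ = (a b; Mc₁ d)`, `γ' = (a, Mb; c₁, d)`
(`diag(M,1) γ = γ' diag(M,1)`): `M · 2πi c₁/(c₁ M z + d) = 2πi (Mc₁)/((Mc₁) z + d)`. [folklore] -/
theorem D2_slash_diagGL (a b c₁ d : ℤ) (h : (!![a, b; (M : ℤ) * c₁, d]).det = 1)
    (h' : (!![a, (M : ℤ) * b; c₁, d]).det = 1) :
    D2 (⟨!![a, (M : ℤ) * b; c₁, d], h'⟩ : SL(2, ℤ)) ∣[(2 : ℤ)]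
        (glCast ((diagGL (M : ℚ) 1 (Nat.cast_pos.mpr (NeZero.pos M)) one_pos :
          GL(2, ℚ)⁺) : GL (Fin 2) ℚ)) =
      D2 (⟨!![a, b; (M : ℤ) * c₁, d], h⟩ : SL(2, ℤ)) := by
  funext τ
  rw [slash_two_diagGL_apply]
  simp only [D2, ModularGroup.denom_apply]
  have hτ : (((⟨(M : ℝ), Nat.cast_pos.mpr (NeZero.pos M)⟩ : {x : ℝ // 0 < x}) • τ : ℍ) : ℂ) =
      (M : ℂ) * τ := by
    simp [UpperHalfPlane.coe_pos_real_smul]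
  rw [hτ]
  simp only [Matrix.of_apply, Matrix.cons_val', Matrix.cons_val_zero, Matrix.cons_val_one,
    Matrix.cons_val_fin_one, Int.cast_mul, Int.cast_natCast]
  ring

/-- `(f - g) ∣_k A = f ∣_k A - g ∣_k A` for `A ∈ GL₂(ℝ)`. [folklore] -/
theorem sub_slash_GL (k : ℤ) (f g : ℍ → ℂ) (A : GL (Fin 2) ℝ) :
    (f - g) ∣[k] A = f ∣[k] A - g ∣[k] A := by
  rw [sub_eq_add_neg, SlashAction.add_slash, SlashAction.neg_slash, ← sub_eq_add_neg]

/-- **`E₂^{(M)}` is invariant under `Γ₀(M)` in weight `2`.** [cite: DiamondShurman2005, §1.2 (Exercise 1.2.8)] -/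
theorem mazurE2_slash_of_mem_gamma0 {γ : SL(2, ℤ)} (hγ : γ ∈ Gamma0 M) :
    mazurE2 M ∣[(2 : ℤ)] γ = mazurE2 M := by
  have hMc : (M : ℤ) ∣ γ 1 0 := by
    rw [Gamma0_mem, ZMod.intCast_zmod_eq_zero_iff_dvd] at hγ
    exact hγ
  obtain ⟨c₁, hc₁⟩ := hMc
  have hdet : (!![γ 0 0, γ 0 1; (M : ℤ) * c₁, γ 1 1]).det = 1 := by
    rw [← hc₁, Matrix.det_fin_two_of]
    have := Matrix.SpecialLinearGroup.det_coe γ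
    rw [Matrix.det_fin_two] at this
    linear_combination this
  have hdet' : (!![γ 0 0, (M : ℤ) * γ 0 1; c₁, γ 1 1]).det = 1 := by
    rw [Matrix.det_fin_two_of] at hdet ⊢
    linear_combination hdet
  have hγeq : γ = (⟨!![γ 0 0, γ 0 1; (M : ℤ) * c₁, γ 1 1], hdet⟩ : SL(2, ℤ)) := by
    ext i j
    fin_cases i <;> fin_cases j <;> simp [hc₁]
  set γ' : SL(2, ℤ) := ⟨!![γ 0 0, (M : ℤ) * γ 0 1; c₁, γ 1 1], hdet'⟩ with hγ'
  have hprod := glCast_diagGL_mul_mapGL_of_dvd M (γ 0 0) (γ 0 1) c₁ (γ 1 1) hdet hdet'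
  rw [← hγeq] at hprod
  have hD := D2_slash_diagGL M (γ 0 0) (γ 0 1) c₁ (γ 1 1) hdet hdet'
  rw [← hγeq] at hD
  -- `(E₂ ∣ α_M) ∣ γ = (E₂ ∣ γ') ∣ α_M`
  have hslash : (E2 ∣[(2 : ℤ)] (glCast ((diagGL (M : ℚ) 1
      (Nat.cast_pos.mpr (NeZero.pos M)) one_pos : GL(2, ℚ)⁺) : GL (Fin 2) ℚ))) ∣[(2 : ℤ)] γ =
      (E2 ∣[(2 : ℤ)] γ') ∣[(2 : ℤ)] (glCast ((diagGL (M : ℚ) 1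
        (Nat.cast_pos.mpr (NeZero.pos M)) one_pos : GL(2, ℚ)⁺) : GL (Fin 2) ℚ)) := by
    rw [ModularForm.SL_slash, ModularForm.SL_slash, ← SlashAction.slash_mul,
      ← SlashAction.slash_mul]
    congr 1
  have hsub : ∀ (f g : ℍ → ℂ) (δ : SL(2, ℤ)),
      (f - g) ∣[(2 : ℤ)] δ = f ∣[(2 : ℤ)] δ - g ∣[(2 : ℤ)] δ := fun f g δ ↦ by
    simpa using sub_smul_slash_SL2 (k := (2 : ℤ)) f g 1 δ
  rw [mazurE2, hsub, hslash, E2_slash_action γ, E2_slash_action γ']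
  have hκ : ((E2 - (1 / (2 * riemannZeta 2)) • D2 γ') ∣[(2 : ℤ)] (glCast ((diagGL (M : ℚ) 1
      (Nat.cast_pos.mpr (NeZero.pos M)) one_pos : GL(2, ℚ)⁺) : GL (Fin 2) ℚ))) =
      E2 ∣[(2 : ℤ)] (glCast ((diagGL (M : ℚ) 1 (Nat.cast_pos.mpr (NeZero.pos M)) one_pos :
        GL(2, ℚ)⁺) : GL (Fin 2) ℚ)) - (1 / (2 * riemannZeta 2)) • D2 γ := by
    rw [sub_slash_GL, ModularForm.smul_slash, σ_glCast, hD]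
  rw [hκ, sub_sub_sub_cancel_right]

end Mazur

/-! ### Constant terms of `E₂^{(M)} ∣₂ γ` at all cusps -/

section MazurCusps

variable (M : ℕ) [NeZero M]

/-- **Constant term of `E₂^{(M)} ∣₂ γ` at `i∞` when `M ∣ c`: `1 - M`.** [cite: Mazur1977, II.5; BillereyMenares2018, Cor. 5] -/
theorem tendsto_mazurE2_slash_atImInfty_of_dvd {γ : SL(2, ℤ)} (hγ : (M : ℤ) ∣ γ 1 0) :
    Tendsto (mazurE2 M ∣[(2 : ℤ)] γ) atImInfty (𝓝 (1 - (M : ℂ))) := by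
  obtain ⟨c₁, hc₁⟩ := hγ
  have hdet : (!![γ 0 0, γ 0 1; (M : ℤ) * c₁, γ 1 1]).det = 1 := by
    rw [← hc₁, Matrix.det_fin_two_of]
    have := Matrix.SpecialLinearGroup.det_coe γ
    rw [Matrix.det_fin_two] at this
    linear_combination this
  have hdet' : (!![γ 0 0, (M : ℤ) * γ 0 1; c₁, γ 1 1]).det = 1 := by
    rw [Matrix.det_fin_two_of] at hdet ⊢
    linear_combination hdet
  have hγeq : γ = (⟨!![γ 0 0, γ 0 1; (M : ℤ) * c₁, γ 1 1], hdet⟩ : SL(2, ℤ)) := by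
    ext i j
    fin_cases i <;> fin_cases j <;> simp [hc₁]
  set γ' : SL(2, ℤ) := ⟨!![γ 0 0, (M : ℤ) * γ 0 1; c₁, γ 1 1], hdet'⟩ with hγ'
  have hprod := glCast_diagGL_mul_mapGL_of_dvd M (γ 0 0) (γ 0 1) c₁ (γ 1 1) hdet hdet'
  rw [← hγeq] at hprod
  have hslash : (E2 ∣[(2 : ℤ)] (glCast ((diagGL (M : ℚ) 1
      (Nat.cast_pos.mpr (NeZero.pos M)) one_pos : GL(2, ℚ)⁺) : GL (Fin 2) ℚ))) ∣[(2 : ℤ)] γ =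
      (E2 ∣[(2 : ℤ)] γ') ∣[(2 : ℤ)] (glCast ((diagGL (M : ℚ) 1
        (Nat.cast_pos.mpr (NeZero.pos M)) one_pos : GL(2, ℚ)⁺) : GL (Fin 2) ℚ)) := by
    rw [ModularForm.SL_slash, ModularForm.SL_slash, ← SlashAction.slash_mul,
      ← SlashAction.slash_mul]
    congr 1
  have hsub : ∀ (f g : ℍ → ℂ) (δ : SL(2, ℤ)),
      (f - g) ∣[(2 : ℤ)] δ = f ∣[(2 : ℤ)] δ - g ∣[(2 : ℤ)] δ := fun f g δ ↦ by
    simpa using sub_smul_slash_SL2 (k := (2 : ℤ)) f g 1 δ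
  rw [mazurE2, hsub, hslash]
  refine (tendsto_E2_slash_atImInfty γ).sub ?_
  have h10 : (glCast ((diagGL (M : ℚ) 1 (Nat.cast_pos.mpr (NeZero.pos M)) one_pos :
      GL(2, ℚ)⁺) : GL (Fin 2) ℚ)) 1 0 = 0 := by simp [glCast, diagGL]
  have h := tendsto_slash_atImInfty_of_upperTriangular (k := (2 : ℤ)) h10 (det_glCast_pos _)
    (tendsto_E2_slash_atImInfty γ')
  convert h using 2
  have hdetM : (((glCast ((diagGL (M : ℚ) 1 (Nat.cast_pos.mpr (NeZero.pos M)) one_pos :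
      GL(2, ℚ)⁺) : GL (Fin 2) ℚ)).det.val : ℝ) : ℂ) = M := by
    simp [glCast, Matrix.GeneralLinearGroup.map_det, diagGL, Matrix.det_fin_two]
  have h11 : (((glCast ((diagGL (M : ℚ) 1 (Nat.cast_pos.mpr (NeZero.pos M)) one_pos :
      GL(2, ℚ)⁺) : GL (Fin 2) ℚ)) 1 1 : ℝ) : ℂ) = 1 := by simp [glCast, diagGL]
  rw [hdetM, h11, _root_.one_zpow, mul_one, one_mul, show (2 : ℤ) - 1 = 1 by norm_num, zpow_one]

/-- **Constant term of `E₂^{(M)} ∣₂ γ` at `i∞` when `gcd(c, M) = 1`: `1 - 1/M`.** [cite: Mazur1977, II.5; BillereyMenares2018, Cor. 5] -/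
theorem tendsto_mazurE2_slash_atImInfty_of_isCoprime {γ : SL(2, ℤ)} (hγ : IsCoprime (γ 1 0) M) :
    Tendsto (mazurE2 M ∣[(2 : ℤ)] γ) atImInfty (𝓝 (1 - (M : ℂ)⁻¹)) := by
  obtain ⟨x, y, hxy⟩ := hγ
  have hdetγ : (!![γ 0 0, γ 0 1; γ 1 0, γ 1 1]).det = 1 := by
    rw [Matrix.det_fin_two_of]
    have := Matrix.SpecialLinearGroup.det_coe γ
    rw [Matrix.det_fin_two] at this
    exact this
  have hγeq : γ = (⟨!![γ 0 0, γ 0 1; γ 1 0, γ 1 1], hdetγ⟩ : SL(2, ℤ)) := by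
    ext i j
    fin_cases i <;> fin_cases j <;> simp
  have hdet' : (!![(M : ℤ) * γ 0 0, γ 0 1 - γ 0 0 * (x * γ 1 1); γ 1 0, γ 1 1 * y]).det = 1 := by
    rw [Matrix.det_fin_two_of] at hdetγ ⊢
    linear_combination (γ 0 0 * γ 1 1) * hxy + hdetγ
  have hT : (!![(1 : ℤ), x * γ 1 1; 0, 1]).det = 1 := by
    rw [Matrix.det_fin_two_of]; ring
  set γ' : SL(2, ℤ) := ⟨!![(M : ℤ) * γ 0 0, γ 0 1 - γ 0 0 * (x * γ 1 1); γ 1 0, γ 1 1 * y], hdet'⟩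
    with hγ'
  set T' : SL(2, ℤ) := ⟨!![(1 : ℤ), x * γ 1 1; 0, 1], hT⟩ with hT'
  have hprod := glCast_diagGL_mul_mapGL_of_isCoprime M (γ 0 0) (γ 0 1) (γ 1 0) (γ 1 1) x y
    hdetγ hxy hdet' hT
  rw [← hγeq] at hprod
  have hslash : (E2 ∣[(2 : ℤ)] (glCast ((diagGL (M : ℚ) 1
      (Nat.cast_pos.mpr (NeZero.pos M)) one_pos : GL(2, ℚ)⁺) : GL (Fin 2) ℚ))) ∣[(2 : ℤ)] γ =
      ((E2 ∣[(2 : ℤ)] γ') ∣[(2 : ℤ)] (glCast ((diagGL 1 (M : ℚ) one_pos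
        (Nat.cast_pos.mpr (NeZero.pos M)) : GL(2, ℚ)⁺) : GL (Fin 2) ℚ))) ∣[(2 : ℤ)] T' := by
    rw [ModularForm.SL_slash, ModularForm.SL_slash, ModularForm.SL_slash,
      ← SlashAction.slash_mul, ← SlashAction.slash_mul, ← SlashAction.slash_mul]
    congr 1
    rw [mul_assoc] at hprod
    exact hprod
  have hsub : ∀ (f g : ℍ → ℂ) (δ : SL(2, ℤ)),
      (f - g) ∣[(2 : ℤ)] δ = f ∣[(2 : ℤ)] δ - g ∣[(2 : ℤ)] δ := fun f g δ ↦ by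
    simpa using sub_smul_slash_SL2 (k := (2 : ℤ)) f g 1 δ
  rw [mazurE2, hsub, hslash]
  refine (tendsto_E2_slash_atImInfty γ).sub ?_
  have h10 : (glCast ((diagGL 1 (M : ℚ) one_pos (Nat.cast_pos.mpr (NeZero.pos M)) :
      GL(2, ℚ)⁺) : GL (Fin 2) ℚ)) 1 0 = 0 := by simp [glCast, diagGL]
  have h := tendsto_slash_atImInfty_of_upperTriangular (k := (2 : ℤ)) h10 (det_glCast_pos _)
    (tendsto_E2_slash_atImInfty γ')
  have hT10 : T' 1 0 = 0 := by simp [hT']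
  have hT11 : T' 1 1 = 1 := by simp [hT']
  have h2 := tendsto_slash_SL2_atImInfty_of_upperTriangular (k := (2 : ℤ)) hT10 hT11 h
  convert h2 using 2
  have hdetM : (((glCast ((diagGL 1 (M : ℚ) one_pos (Nat.cast_pos.mpr (NeZero.pos M)) :
      GL(2, ℚ)⁺) : GL (Fin 2) ℚ)).det.val : ℝ) : ℂ) = M := by
    simp [glCast, Matrix.GeneralLinearGroup.map_det, diagGL, Matrix.det_fin_two]
  have h11 : (((glCast ((diagGL 1 (M : ℚ) one_pos (Nat.cast_pos.mpr (NeZero.pos M)) :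
      GL(2, ℚ)⁺) : GL (Fin 2) ℚ)) 1 1 : ℝ) : ℂ) = M := by simp [glCast, diagGL]
  have hM0 : (M : ℂ) ≠ 0 := by exact_mod_cast NeZero.ne M
  rw [hdetM, h11, one_mul, show (2 : ℤ) - 1 = 1 by norm_num, zpow_one, ← zpow_one_add₀ hM0,
    show (1 : ℤ) + -2 = -1 by norm_num, _root_.zpow_neg_one]

/-- **`E₂^{(M)}` is bounded at every cusp** (`M` prime). [folklore] -/
theorem isBoundedAtImInfty_mazurE2_slash (hM : M.Prime) (γ : SL(2, ℤ)) :
    IsBoundedAtImInfty (mazurE2 M ∣[(2 : ℤ)] γ) := by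
  rcases dvd_or_isCoprime_of_prime hM (γ 1 0) with h | h
  · exact (tendsto_mazurE2_slash_atImInfty_of_dvd M h).isBigO_one ℝ
  · exact (tendsto_mazurE2_slash_atImInfty_of_isCoprime M h).isBigO_one ℝ

/-- **Mazur's Eisenstein series `E₂^{(M)} = E₂(z) - M E₂(Mz)` as a modular form of weight `2` on
`Γ₁(M)`** (`M` prime; it is invariant under all of `Γ₀(M)`, `mazurEisensteinMF_slash_of_mem_gamma0`).
[cite: DiamondShurman2005, §1.2; Mazur1977, II.5] -/
def mazurEisensteinMF (hM : M.Prime) : ModularForm (Gamma1 M) 2 where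
  toFun := mazurE2 M
  slash_action_eq' A hA := by
    obtain ⟨A, (hA : A ∈ Gamma1 M), rfl⟩ := hA
    exact mazurE2_slash_of_mem_gamma0 M (Gamma1_in_Gamma0 M hA)
  holo' := E2_mdifferentiable.sub (E2_mdifferentiable.slash _ _)
  bdd_at_cusps' {c} hc := by
    rw [Subgroup.IsArithmetic.isCusp_iff_isCusp_SL2Z] at hc
    rw [OnePoint.isBoundedAt_iff_forall_SL2Z hc]
    intro γ _
    exact isBoundedAtImInfty_mazurE2_slash M hM γ

/-- The function of `mazurEisensteinMF` is `mazurE2`. [folklore] -/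
@[simp] theorem coe_mazurEisensteinMF (hM : M.Prime) :
    (⇑(mazurEisensteinMF M hM) : ℍ → ℂ) = mazurE2 M := rfl

/-- **`E₂^{(M)} ∣₂ γ = E₂^{(M)}` on `Γ₀(M)`** — trivial nebentypus. [cite: DiamondShurman2005, §1.2] -/
theorem mazurEisensteinMF_slash_of_mem_gamma0 (hM : M.Prime) {γ : SL(2, ℤ)} (hγ : γ ∈ Gamma0 M) :
    (⇑(mazurEisensteinMF M hM) : ℍ → ℂ) ∣[(2 : ℤ)] γ = (⇑(mazurEisensteinMF M hM) : ℍ → ℂ) :=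
  mazurE2_slash_of_mem_gamma0 M hγ

/-- The lower-right entry of `γ ∈ Γ₀(M)` is a unit modulo `M`. [folklore] -/
theorem isUnit_entry_of_mem_gamma0 {γ : SL(2, ℤ)} (hγ : γ ∈ Gamma0 M) :
    IsUnit (((γ 1 1 : ℤ) : ZMod M)) := by
  have hdet := Matrix.SpecialLinearGroup.det_coe γ
  rw [Matrix.det_fin_two] at hdet
  have hc : ((γ 1 0 : ℤ) : ZMod M) = 0 := Gamma0_mem.1 hγ
  have h : ((γ 0 0 : ℤ) : ZMod M) * ((γ 1 1 : ℤ) : ZMod M) = 1 := by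
    have := congrArg ((↑) : ℤ → ZMod M) hdet
    push_cast at this
    rw [hc, mul_zero, sub_zero] at this
    exact this
  exact IsUnit.of_mul_eq_one_right _ h

/-- **Nebentypus law with the trivial character**: `E₂^{(M)} ∣₂ γ = 𝟙(d) • E₂^{(M)}` on `Γ₀(M)`
(the shape of the hypotheses of the cuspidal-lifting criterion). [folklore] -/
theorem mazurEisensteinMF_slash_eq_one_apply_smul (hM : M.Prime) {γ : SL(2, ℤ)}
    (hγ : γ ∈ Gamma0 M) :
    (⇑(mazurEisensteinMF M hM) : ℍ → ℂ) ∣[(2 : ℤ)] γ =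
      (1 : DirichletCharacter ℂ M) ((γ 1 1 : ℤ) : ZMod M) • (⇑(mazurEisensteinMF M hM) : ℍ → ℂ) := by
  rw [mazurEisensteinMF_slash_of_mem_gamma0 M hM hγ, MulChar.one_apply (isUnit_entry_of_mem_gamma0 M hγ),
    one_smul]

end MazurCusps

/-! ### `q`-expansion, `p`-integrality, and the constant terms modulo `p` -/

section MazurQExpansion

variable (M : ℕ) [NeZero M]

/-- `𝕢₁(Mτ) = 𝕢₁(τ)^M` (private copy of `qParam_one_natMul` of `NewformsLevelRaising`). [folklore] -/
private theorem qParam_one_natMul' (τ : ℍ) :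
    Periodic.qParam 1 ((((⟨(M : ℝ), Nat.cast_pos.mpr (NeZero.pos M)⟩ : {x : ℝ // 0 < x}) • τ :
      ℍ) : ℂ)) = Periodic.qParam 1 τ ^ M := by
  have hτ : ((((⟨(M : ℝ), Nat.cast_pos.mpr (NeZero.pos M)⟩ : {x : ℝ // 0 < x}) • τ : ℍ) : ℂ)) =
      (M : ℂ) * τ := by
    simp [UpperHalfPlane.coe_pos_real_smul]
  rw [hτ]
  simp only [Periodic.qParam, Complex.ofReal_one, div_one, ← Complex.exp_nat_mul]
  ring_nf

/-- The `q`-expansion of `E₂^{(M)}(τ) = E₂(τ) - M E₂(Mτ)` as a `HasSum`. [folklore] -/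
theorem hasSum_qExpansion_mazurE2 (τ : ℍ) :
    HasSum (fun n : ℕ ↦ ((if n = 0 then 1 else -24 * (σ 1 n : ℂ)) -
        (M : ℂ) * (if M ∣ n then (if n / M = 0 then 1 else -24 * (σ 1 (n / M) : ℂ)) else 0)) •
          Periodic.qParam 1 τ ^ n) (mazurE2 M τ) := by
  have hd : 0 < M := NeZero.pos M
  rw [mazurE2_apply]
  have h1 := hasSum_qExpansion_E2' τ
  have h2 := hasSum_qExpansion_E2'
    ((⟨(M : ℝ), Nat.cast_pos.mpr (NeZero.pos M)⟩ : {x : ℝ // 0 < x}) • τ)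
  rw [qParam_one_natMul'] at h2
  -- reindex `h2` over multiples of `M`
  have h3 : HasSum (fun n : ℕ ↦ ((M : ℂ) * (if M ∣ n then
      (if n / M = 0 then 1 else -24 * (σ 1 (n / M) : ℂ)) else 0)) • Periodic.qParam 1 τ ^ n)
      ((M : ℂ) * E2 ((⟨(M : ℝ), Nat.cast_pos.mpr (NeZero.pos M)⟩ : {x : ℝ // 0 < x}) • τ)) := by
    have h2' := h2.mul_left (M : ℂ)
    refine ((mul_right_injective₀ hd.ne').hasSum_iff ?_).mp ?_
    · intro m hm
      have : ¬ M ∣ m := by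
        rintro ⟨j, rfl⟩
        exact hm ⟨j, rfl⟩
      simp [this]
    · have hfun : ((fun n : ℕ ↦ ((M : ℂ) * (if M ∣ n then
          (if n / M = 0 then 1 else -24 * (σ 1 (n / M) : ℂ)) else 0)) • Periodic.qParam 1 τ ^ n) ∘
            fun x ↦ M * x) =
          fun i ↦ (M : ℂ) * ((if i = 0 then 1 else -24 * (σ 1 i : ℂ)) •
            (Periodic.qParam 1 τ ^ M) ^ i) := by
        funext m
        simp only [Function.comp_apply, smul_eq_mul]
        rw [if_pos (dvd_mul_right M m), Nat.mul_div_cancel_left m hd, pow_mul, mul_assoc]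
      rw [hfun]
      exact h2'
  have h := h1.sub h3
  have hfun : (fun n : ℕ ↦ ((if n = 0 then 1 else -24 * (σ 1 n : ℂ)) -
      (M : ℂ) * (if M ∣ n then (if n / M = 0 then 1 else -24 * (σ 1 (n / M) : ℂ)) else 0)) •
        Periodic.qParam 1 τ ^ n) =
      fun n : ℕ ↦ (if n = 0 then 1 else -24 * (σ 1 n : ℂ)) • Periodic.qParam 1 τ ^ n -
        ((M : ℂ) * (if M ∣ n then (if n / M = 0 then 1 else -24 * (σ 1 (n / M) : ℂ)) else 0)) •
          Periodic.qParam 1 τ ^ n := by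
    funext n
    simp only [smul_eq_mul]
    ring
  rw [hfun]
  exact h

/-- `(1 : ℝ)` is a strict period of `Γ₁(L)`. [folklore] -/
private theorem one_mem_strictPeriods_gamma1' (L : ℕ) :
    (1 : ℝ) ∈ (Gamma1 L : Subgroup (GL (Fin 2) ℝ)).strictPeriods := by simp

/-- **The `q`-expansion of Mazur's Eisenstein series**: `a_0 = 1 - M` and
`a_n = -24 (σ₁(n) - M [M ∣ n] σ₁(n/M))` for `n ≥ 1`. [cite: DiamondShurman2005, §1.2; Mazur1977, II.5] -/
theorem qExpansion_coeff_mazurEisensteinMF (hM : M.Prime) (n : ℕ) :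
    (qExpansion 1 ⇑(mazurEisensteinMF M hM)).coeff n =
      if n = 0 then 1 - (M : ℂ)
      else -24 * ((σ 1 n : ℂ) - (M : ℂ) * (if M ∣ n then (σ 1 (n / M) : ℂ) else 0)) := by
  have h := ModularFormClass.qExpansion_coeff_unique one_pos (one_mem_strictPeriods_gamma1' M)
    (f := mazurEisensteinMF M hM)
    (c := fun n : ℕ ↦ (if n = 0 then 1 else -24 * (σ 1 n : ℂ)) -
      (M : ℂ) * (if M ∣ n then (if n / M = 0 then 1 else -24 * (σ 1 (n / M) : ℂ)) else 0))
    (fun τ ↦ hasSum_qExpansion_mazurE2 M τ) n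
  rw [← h]
  by_cases hn : n = 0
  · subst hn
    simp
  · have hnM : M ∣ n → n / M ≠ 0 := fun hMn ↦ by
      obtain ⟨j, rfl⟩ := hMn
      rw [Nat.mul_div_cancel_left j (NeZero.pos M)]
      rintro rfl
      exact hn (mul_zero M)
    by_cases hMn : M ∣ n
    · rw [if_neg hn, if_neg hn, if_pos hMn, if_pos hMn, if_neg (hnM hMn)]
      ring
    · rw [if_neg hn, if_neg hn, if_neg hMn, if_neg hMn]
      ring

variable {p : ℕ} [Fact p.Prime]

/-- `v(z) ≤ 1` in `ℚ̄_p` for an integer `z`. [folklore] -/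
private theorem valuation_intCast_le_one (z : ℤ) : Valued.v ((z : PadicAlgCl p)) ≤ 1 := by
  rw [PadicAlgCl.valuation_def, ← NNReal.coe_le_coe, coe_nnnorm, NNReal.coe_one,
    ← map_intCast (algebraMap ℚ_[p] (PadicAlgCl p)) z]
  change ‖((z : ℚ_[p]) : PadicAlgCl p)‖ ≤ 1
  rw [PadicAlgCl.norm_extends]
  exact Padic.norm_int_le_one z

/-- `v(z) < 1` in `ℚ̄_p` for an integer `z` divisible by `p`. [folklore] -/
private theorem valuation_intCast_lt_one {z : ℤ} (hz : (p : ℤ) ∣ z) :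
    Valued.v ((z : PadicAlgCl p)) < 1 := by
  rw [PadicAlgCl.valuation_def, ← NNReal.coe_lt_coe, coe_nnnorm, NNReal.coe_one,
    ← map_intCast (algebraMap ℚ_[p] (PadicAlgCl p)) z]
  change ‖((z : ℚ_[p]) : PadicAlgCl p)‖ < 1
  rw [PadicAlgCl.norm_extends]
  exact Padic.norm_intCast_lt_one_iff.2 hz

/-- `v(M) = 1` in `ℚ̄_p` for `p ∤ M`. [folklore] -/
private theorem valuation_natCast_eq_one {n : ℕ} (hn : ¬ p ∣ n) :
    Valued.v ((n : PadicAlgCl p)) = 1 := by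
  rw [PadicAlgCl.valuation_def, ← NNReal.coe_inj, coe_nnnorm, NNReal.coe_one,
    ← map_natCast (algebraMap ℚ_[p] (PadicAlgCl p)) n]
  change ‖((n : ℚ_[p]) : PadicAlgCl p)‖ = 1
  rw [PadicAlgCl.norm_extends, Padic.norm_natCast_eq_one_iff]
  exact (Nat.Prime.coprime_iff_not_dvd Fact.out).2 hn

/-- **The `q`-expansion of `E₂^{(M)}` is `p`-integral** (indeed integral). [folklore] -/
theorem valuation_qExpansion_coeff_mazurEisensteinMF_le_one (ι : PadicAlgCl p ≃+* ℂ)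
    (hM : M.Prime) (n : ℕ) :
    Valued.v (ι.symm ((qExpansion 1 ⇑(mazurEisensteinMF M hM)).coeff n)) ≤ 1 := by
  rw [qExpansion_coeff_mazurEisensteinMF]
  split_ifs with hn hMn
  · have : (1 - (M : ℂ)) = ((1 - (M : ℤ) : ℤ) : ℂ) := by push_cast; ring
    rw [this, map_intCast]
    exact valuation_intCast_le_one _
  · have : -24 * ((σ 1 n : ℂ) - (M : ℂ) * (σ 1 (n / M) : ℂ)) =
        ((-24 * ((σ 1 n : ℤ) - (M : ℤ) * (σ 1 (n / M) : ℤ)) : ℤ) : ℂ) := by push_cast; ring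
    rw [this, map_intCast]
    exact valuation_intCast_le_one _
  · have : -24 * ((σ 1 n : ℂ) - (M : ℂ) * 0) = ((-24 * (σ 1 n : ℤ) : ℤ) : ℂ) := by push_cast; ring
    rw [this, map_intCast]
    exact valuation_intCast_le_one _

/-- **All constant terms of `E₂^{(M)}` vanish modulo `p` when `p ∣ M - 1`** (`M` prime): for every
`γ ∈ SL₂(ℤ)`, `E₂^{(M)} ∣₂ γ → c_γ ∈ {1 - M, 1 - 1/M}` with `‖ι⁻¹(c_γ)‖_p < 1` — the hypothesis
`l ∣ M - 1` of Mazur's theorem, i.e. `η(M) M^k = 1` with `(N, k) = (1, 2)` in Billerey–Menares.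
[cite: Mazur1977, Prop. II.9.7; BillereyMenares2018, Thm. 1 and §3.2] -/
theorem exists_tendsto_mazurEisensteinMF_slash_valuation_lt_one (ι : PadicAlgCl p ≃+* ℂ)
    (hM : M.Prime) (hpM : p ∣ M - 1) (γ : SL(2, ℤ)) :
    ∃ c : ℂ, Tendsto ((⇑(mazurEisensteinMF M hM) : ℍ → ℂ) ∣[(2 : ℤ)] γ) atImInfty (𝓝 c) ∧
      Valued.v (ι.symm c) < 1 := by
  have hM1 : 1 ≤ M := hM.one_lt.le
  have hdvd : (p : ℤ) ∣ ((M : ℤ) - 1) := by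
    have : ((M - 1 : ℕ) : ℤ) = (M : ℤ) - 1 := by push_cast [Nat.cast_sub hM1]; ring
    rw [← this]; exact_mod_cast hpM
  have hv1 : Valued.v (((M : PadicAlgCl p)) - 1) < 1 := by
    have : ((M : PadicAlgCl p)) - 1 = (((M : ℤ) - 1 : ℤ) : PadicAlgCl p) := by push_cast; ring
    rw [this]; exact valuation_intCast_lt_one hdvd
  have hpM' : ¬ p ∣ M := by
    intro h
    have hp := (Fact.out : p.Prime)
    have h1 : p ∣ M - (M - 1) := Nat.dvd_sub h hpM
    rw [Nat.sub_sub_self hM1] at h1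
    exact hp.one_lt.ne' (Nat.dvd_one.1 h1)
  rcases dvd_or_isCoprime_of_prime hM (γ 1 0) with h | h
  · refine ⟨_, tendsto_mazurE2_slash_atImInfty_of_dvd M h, ?_⟩
    rw [map_sub, map_one, map_natCast, ← Valuation.map_neg, neg_sub]
    exact hv1
  · refine ⟨_, tendsto_mazurE2_slash_atImInfty_of_isCoprime M h, ?_⟩
    have hM0 : (M : PadicAlgCl p) ≠ 0 := by
      intro h0
      have := valuation_natCast_eq_one (p := p) hpM'
      rw [h0, Valuation.map_zero] at this
      exact zero_ne_one this
    have : ι.symm (1 - (M : ℂ)⁻¹) = (((M : PadicAlgCl p)) - 1) * ((M : PadicAlgCl p))⁻¹ := by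
      rw [map_sub, map_one, map_inv₀, map_natCast, sub_mul, mul_inv_cancel₀ hM0, one_mul]
    rw [this, Valuation.map_mul, map_inv₀, valuation_natCast_eq_one hpM', inv_one, mul_one]
    exact hv1

end MazurQExpansion

end Literature.NumberTheory.EllipticCurves.ModularForms
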